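import Literature.AlgebraicGeometry.Resolution.PointBlowupFlagStepTyped
import HarnessLib

/-!
# Hauser–Perlega, Proposition 4 case (i) assembled on the atlas: every case-(i) flag of the successor is beaten

H. Hauser, S. Perlega, *Resolving surface singularities in positive characteristic*, Publ. RIMS Kyoto Univ. **60**
(2024) 767–813 [cite: HauserPerlega2024], Prop. 4 proof case (i) (p. 794 l. 22 – p. 795 l. 5): "`n_𝓖 = 0` and `t = 0`
… `d_𝓖 = d′_res ≤ d_res = d_𝓕`. Assume that equality holds … If `G₁ = V(z,x)` and `d_res ≥ pᵉ`, the numeral `s_𝓖` hence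
has the minimal value `s_𝓖 = d_res!` … Consequently, we may assume … `G₁ = V(z,y)` … This proves that `s_𝓖 < s_𝓕`."

## What is proved (sorry-free; NO new definition, NO named fact)

Along the atlas step `step q x 0 s` (two letters, `q = pᵉ`, `E = excLetters s ∈ {∅, {x}}`, `F ≠ 0` clean, `q < ord F`,
`d_res ≥ q`, so that `E′ = {x}`):
* `sValue q {x} ⟨x, y, 0⟩ F′ = d_res!` when `d′_res = d_res` — **the swapped flag `G₁ = V(z, x)` is minimal**
  (`sValue_swap_step_eq_factorial`), and `d_res! ≤ sValue q {x} ⟨y, x, h⟩ F′` (`factorial_le_sValue_step`);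
* **[HP24, Prop. 4 case (i)] on the atlas** (`invCaseN0_step_lt`): if `a` is not terminal, there is a case-(i) flag
  `⟨y, x, h⋆⟩` at `a` (the maximizing one of Proposition 3) whose invariant `(d_res, 0, s)` STRICTLY exceeds the
  invariant `(d′_res, 0, s_𝓖)` of EVERY case-(i) flag `𝓖` of the successor — either `d′_res < d_res`, or `d′_res = d_res`
  and `s_𝓖 + d_res! ≤ s` (flags `G₁ = V(z₁, y + h(x))`) resp. `s_𝓖 = d_res! < 2·d_res! ≤ s` (the flag `G₁ = V(z, x)`).

## What is NOT proved here

The companion branch `0 < d_res < pᵉ` on the atlas; `t ≠ 0`; tangent flags of the successor (cases (iii)/(iv) —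
(iii) is `PointBlowupFlagTangentStep`); the assembly of `FlagInvariantDropsStatement`.

Provenance: seat res-D-pv-058 acting as res-L1-w43-stub-6 (cell res-hironaka, chain W4.3), 2026-08-27; a Literature
transcription of a PRINTED, refereed proposition in the tree's polynomial/power-series model — not a statement about
any manuscript under adjudication.
-/

noncomputable section

open MvPolynomial Finset
open scoped BigOperators

namespace Literature.AlgebraicGeometry.Resolution

open Literature.AlgebraicGeometry.Resolution.Hauser2010
open Literature.AlgebraicGeometry.Resolution.PointBlowup
open Literature.AlgebraicGeometry.Resolution.HauserWagner2014

namespace HauserPerlega2024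

section CaseOne

variable {σ : Type*} [Fintype σ] [DecidableEq σ] {K : Type*} [Field K] [DecidableEq K]

omit [Fintype σ] [DecidableEq σ] [DecidableEq K] in
/-- the exponent `x^a y^b` evaluated at `x`. [folklore] -/
private theorem t_l {x y : σ} (hxy : x ≠ y) (a b : ℕ) : (Finsupp.single x a + Finsupp.single y b) x = a := by
  classical
  rw [Finsupp.add_apply, Finsupp.single_eq_same, Finsupp.single_apply, if_neg (Ne.symm hxy), add_zero]

omit [Fintype σ] [DecidableEq σ] [DecidableEq K] in
/-- the exponent `x^a y^b` evaluated at `y`. [folklore] -/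
private theorem t_r {x y : σ} (hxy : x ≠ y) (a b : ℕ) : (Finsupp.single x a + Finsupp.single y b) y = b := by
  classical
  rw [Finsupp.add_apply, Finsupp.single_eq_same, Finsupp.single_apply, if_neg hxy, zero_add]

omit [Fintype σ] [DecidableEq σ] [DecidableEq K] in
/-- two letters: an exponent is determined by its two entries. [folklore] -/
private theorem t_eq2 {x y : σ} (hσ : ∀ l, l = x ∨ l = y) {d d' : σ →₀ ℕ} (hx : d x = d' x) (hy : d y = d' y) :
    d = d' := by
  ext l
  rcases hσ l with rfl | rfl
  · exact hx
  · exact hy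

omit [Fintype σ] [DecidableEq σ] [DecidableEq K] in
/-- the cleaning is idempotent. [cite: HauserPerlega2024, §2 p. 774 (clean expansion)] -/
theorem cleanSeries_cleanSeries (q : ℕ) (S : MvPowerSeries σ K) : cleanSeries q (cleanSeries q S) = cleanSeries q S := by
  classical
  ext m
  rw [coeff_cleanSeries, coeff_cleanSeries]
  split_ifs <;> rfl

omit [Fintype σ] in
/-- the successor of the atlas step is clean as a series. [cite: HauserPerlega2024, §2 p. 774 l. 18–20 (F′ clean again)] -/
theorem cleanSeries_coe_step (q : ℕ) (j : σ) (b : σ → K) (s : State σ K) :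
    cleanSeries q ((step q j b s).F : MvPowerSeries σ K) = ((step q j b s).F : MvPowerSeries σ K) := by
  show cleanSeries q ((deletePthPowers q (pointTransform q j b s) : MvPolynomial σ K) : MvPowerSeries σ K) =
    ((deletePthPowers q (pointTransform q j b s) : MvPolynomial σ K) : MvPowerSeries σ K)
  rw [coe_deletePthPowers, cleanSeries_cleanSeries]

omit [Fintype σ] [DecidableEq σ] [DecidableEq K] in
/-- `q ≤ ord F` in `ℕ` for `F ≠ 0`. [folklore] -/
private theorem le_toNat_ordZero' {q : ℕ} {F : MvPolynomial σ K} (hF : F ≠ 0) (hq : (q : ℕ∞) ≤ ordZero F) :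
    q ≤ (ordZero F).toNat := by
  have hne : ordZero F ≠ ⊤ := by
    unfold ordZero; rw [Ne, MvPowerSeries.order_eq_top_iff, MvPolynomial.coe_eq_zero_iff]; exact hF
  rw [← ENat.coe_toNat hne] at hq
  exact_mod_cast hq

omit [DecidableEq σ] [DecidableEq K] in
/-- two letters: a sum over all letters has two terms. [folklore] -/
private theorem t_sum2 {M : Type*} [AddCommMonoid M] {x y : σ} (hxy : x ≠ y) (hσ : ∀ l, l = x ∨ l = y) (f : σ → M) :
    ∑ l, f l = f x + f y := by
  classical
  have huniv : (Finset.univ : Finset σ) = {x, y} := by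
    ext l
    simp only [Finset.mem_univ, Finset.mem_insert, Finset.mem_singleton, true_iff]
    exact hσ l
  rw [huniv, Finset.sum_pair hxy]

omit [DecidableEq K] in
/-- **`ord F = r + d_res`** for the exceptional exponent `x^r` of a clean `F ≠ 0` (from the series-level hypotheses of
`exists_excExponent_eq_single`). [cite: HauserPerlega2024, §4 p. 776 (d_res = ord F − ord_{E_a} F)] -/
theorem ordZero_toNat_eq_add (q : ℕ) (x y : σ) (hxy : x ≠ y) (hσ : ∀ l, l = x ∨ l = y) {F : MvPolynomial σ K}
    (hF : F ≠ 0) (hclean : deletePthPowers q F = F) {r d : ℕ}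
    (hminH : ∀ m, MvPowerSeries.coeff m (F : MvPowerSeries σ K) ≠ 0 → r + d ≤ m x + m y)
    (hexH : ∃ m, MvPowerSeries.coeff m (cleanSeries q (F : MvPowerSeries σ K)) ≠ 0 ∧ m x + m y = r + d) :
    (ordZero F).toNat = r + d := by
  classical
  have hne : ordZero F ≠ ⊤ := by
    unfold ordZero; rw [Ne, MvPowerSeries.order_eq_top_iff, MvPolynomial.coe_eq_zero_iff]; exact hF
  obtain ⟨o, ho'⟩ := WithTop.ne_top_iff_exists.mp hne
  have ho : ordZero F = o := ho'.symm
  have htoNat : (ordZero F).toNat = o := by rw [ho]; rfl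
  rw [htoNat]
  apply le_antisymm
  · obtain ⟨m, hm, hdeg⟩ := hexH
    rw [cleanSeries_coe_of_clean q F hclean] at hm
    have h1 : ordZero F ≤ (m.degree : ℕ∞) := by unfold ordZero; exact MvPowerSeries.order_le hm
    rw [ho, Finsupp.degree_eq_sum, t_sum2 hxy hσ] at h1
    have h2 : o ≤ m x + m y := by exact_mod_cast h1
    omega
  · obtain ⟨⟨m₀, hm₀, hdeg₀⟩, -⟩ := (ordZero_eq_nat_iff F o).mp ho
    have h1 := hminH m₀ (by rw [MvPolynomial.coeff_coe]; exact hm₀)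
    rw [Finsupp.degree_eq_sum, t_sum2 hxy hσ] at hdeg₀
    omega

/-- **"If `G₁ = V(z,x)` and `d_res ≥ pᵉ`, the numeral `s_𝓖` hence has the minimal value `s_𝓖 = d_res!`"** (typed): along
`step q x 0 s` with `d′_res = d_res ≥ q`, the swapped case-(i) flag `⟨x, y, 0⟩` of the successor has `sValue = d_res!`
(all terms of `G′` have degree `≥ d_res`, and the corner `c_{d_res} y^{d_res}` of `G′` lies in its row `0`).
[cite: HauserPerlega2024, Prop. 4 proof case (i) p. 794 l. 36–45] -/
theorem sValue_swap_step_eq_factorial (p : ℕ) [Fact p.Prime] [CharP K p] {e : ℕ} (x y : σ) (hxy : x ≠ y)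
    (hσ : ∀ l, l = x ∨ l = y) (s : State σ K) {E : Finset σ} (hE : E = ∅ ∨ E = {x}) (hF : s.F ≠ 0)
    (hclean : deletePthPowers (p ^ e) s.F = s.F) (hq : ((p ^ e : ℕ) : ℕ∞) ≤ ordZero s.F)
    (hqd : p ^ e ≤ dRes E s.F) (hd : dRes {x} (step (p ^ e) x 0 s).F = dRes E s.F) :
    sValue (p ^ e) {x} ⟨x, y, 0⟩ (step (p ^ e) x 0 s).F = ((dRes E s.F).factorial : ℕ∞) := by
  classical
  obtain ⟨r, hr, hxrH, hminH, hexH⟩ := exists_excExponent_eq_single p e x y hxy hσ hE hF hclean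
  have hstep := X_pow_mul_coe_step_zero_of_clean (p ^ e) x y hxy hσ s hclean hq
  set F' := (step (p ^ e) x 0 s).F with hF'
  set d := dRes E s.F with hddef
  set r' := ordVar F' x with hr'def
  have hr'q : r' + p ^ e = r + d := by
    have h1 := le_toNat_ordZero' hF hq
    have ho := ordZero_toNat_eq_add (p ^ e) x y hxy hσ hF hclean hminH hexH
    rw [hr'def, hF', ordVar_step_zero (p ^ e) x y hxy hσ s hF hclean hq]
    rw [ho] at h1 ⊢
    omega
  have hr' : excExponent {x} F' = Finsupp.single x r' := excExponent_singleton x F'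
  have hminH' : ∀ m, MvPowerSeries.coeff m (F' : MvPowerSeries σ K) ≠ 0 → r' + d ≤ m x + m y := by
    intro m hm
    rw [MvPolynomial.coeff_coe] at hm
    have := ordVar_add_dRes_le_of_mem_support x y hxy hσ F' m (MvPolynomial.mem_support_iff.mpr hm)
    rw [hd] at this
    exact this
  -- the residual factor of the swapped flag is `F′/x^{r′}` itself (shift `0`, already clean)
  have hres : residualFlat (p ^ e) {x} ⟨x, y, 0⟩ F' = divMonomial (Finsupp.single x r') (F' : MvPowerSeries σ K) := by
    show divMonomial (excExponent {x} F') (cleanSeries (p ^ e) (substFree y x (-0) F')) = _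
    rw [hr', neg_zero, substFree_eq_subst, subst_shift_zero y x, hF', cleanSeries_coe_step]
  -- the columns of `G′ = F′/x^{r′}`
  set Col : ℕ → PowerSeries K := fun i => PowerSeries.mk fun a =>
    MvPowerSeries.coeff (Finsupp.single y a + Finsupp.single x i) (residualFlat (p ^ e) {x} ⟨x, y, 0⟩ F') with hCol
  have hColv : ∀ i a, PowerSeries.coeff a (Col i) =
      MvPowerSeries.coeff (Finsupp.single x (r' + i) + Finsupp.single y a) (F' : MvPowerSeries σ K) := by
    intro i a
    rw [hCol, PowerSeries.coeff_mk, hres]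
    have hn : Finsupp.single y a + Finsupp.single x i + Finsupp.single x r' =
        Finsupp.single x (r' + i) + Finsupp.single y a := by
      apply t_eq2 hσ
      · rw [Finsupp.add_apply, Finsupp.add_apply, Finsupp.single_apply, if_neg (Ne.symm hxy), Finsupp.single_eq_same,
          Finsupp.single_eq_same, t_l hxy]; omega
      · rw [Finsupp.add_apply, Finsupp.add_apply, Finsupp.single_eq_same, Finsupp.single_apply, if_neg hxy,
          Finsupp.single_apply, if_neg hxy, t_r hxy, add_zero, add_zero]
    show MvPowerSeries.coeff (Finsupp.single y a + Finsupp.single x i + Finsupp.single x r') (F' : MvPowerSeries σ K) = _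
    rw [hn]
  have hsv : sValue (p ^ e) {x} ⟨x, y, 0⟩ F' =
      (Finset.range d).inf (fun i => ((d.factorial / (d - i) : ℕ) : ℕ∞) * (Col i).order) := by
    rw [sValue_eq_inf_of_le (p ^ e) {x} ⟨x, y, 0⟩ F' (by rw [hd]; exact hqd), hd]
  rw [hsv]
  -- degree bound on the columns
  have hmin : ∀ i a, PowerSeries.coeff a (Col i) ≠ 0 → d ≤ i + a := by
    intro i a hne
    rw [hColv] at hne
    have := hminH' _ hne
    rw [t_l hxy, t_r hxy] at this
    omega
  -- the corner `c_d y^d`: row `d` of the `y`-rows of the successor has a non-zero constant term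
  set R : ℕ → PowerSeries K := fun j => PowerSeries.mk fun v =>
    MvPowerSeries.coeff (Finsupp.single x (r + v) + Finsupp.single y j)
      (cleanSeries (p ^ e) (MvPowerSeries.subst (fun l => if l = y then
        (MvPowerSeries.X y : MvPowerSeries σ K) + PowerSeries.subst (MvPowerSeries.X x : MvPowerSeries σ K) (PowerSeries.X * (0 : PowerSeries K))
        else MvPowerSeries.X l) (s.F : MvPowerSeries σ K))) with hRdef
  set R' : ℕ → PowerSeries K := fun j => PowerSeries.mk fun v =>
    MvPowerSeries.coeff (Finsupp.single x (r' + v) + Finsupp.single y j)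
      (cleanSeries (p ^ e) (MvPowerSeries.subst (fun l => if l = y then
        (MvPowerSeries.X y : MvPowerSeries σ K) + PowerSeries.subst (MvPowerSeries.X x : MvPowerSeries σ K) (0 : PowerSeries K)
        else MvPowerSeries.X l) (F' : MvPowerSeries σ K))) with hR'def
  have hcorner := coeff_corner_ne_zero_of_step p x y hxy hσ (s.F : MvPowerSeries σ K) (F' : MvPowerSeries σ K) hstep
    r r' d hr'q hxrH hminH hexH hminH' 0 (map_zero _) R R' (fun j v => by rw [hRdef, PowerSeries.coeff_mk])
    (fun j v => by rw [hR'def, PowerSeries.coeff_mk])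
  have hcorner' : PowerSeries.coeff d (Col 0) ≠ 0 := by
    rw [hColv, Nat.add_zero]
    rw [hR'def, PowerSeries.coeff_mk, subst_shift_zero, cleanSeries_coe_step, Nat.add_zero] at hcorner
    exact hcorner
  have hd1 : 0 < d := lt_of_lt_of_le (Nat.one_le_pow _ _ (Fact.out : p.Prime).pos) hqd
  exact le_antisymm (inf_rows_le_factorial_of_coeff_ne_zero Col hd1 (by omega) hcorner') (factorial_le_inf_rows Col hmin)

/-- **`s_𝓖 ≥ d_res!`** for every case-(i) flag `⟨y, x, h⟩` of the successor when `d′_res = d_res ≥ q` (all terms of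
`G′` have degree `≥ d_res`). [cite: HauserPerlega2024, Prop. 4 proof case (i) p. 794 l. 43–45] -/
theorem factorial_le_sValue_step (p : ℕ) [Fact p.Prime] [CharP K p] {e : ℕ} (x y : σ) (hxy : x ≠ y)
    (hσ : ∀ l, l = x ∨ l = y) (s : State σ K) {E : Finset σ} (hqd : p ^ e ≤ dRes E s.F)
    (hd : dRes {x} (step (p ^ e) x 0 s).F = dRes E s.F) (h : PowerSeries K) (hh : PowerSeries.constantCoeff h = 0) :
    ((dRes E s.F).factorial : ℕ∞) ≤ sValue (p ^ e) {x} ⟨y, x, h⟩ (step (p ^ e) x 0 s).F := by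
  classical
  set F' := (step (p ^ e) x 0 s).F with hF'
  set d := dRes E s.F with hddef
  set r' := ordVar F' x with hr'def
  have hr' : excExponent {x} F' = Finsupp.single x r' := excExponent_singleton x F'
  have hnegh : PowerSeries.constantCoeff (-h) = 0 := by rw [map_neg, hh, neg_zero]
  have hminH' : ∀ m, MvPowerSeries.coeff m (F' : MvPowerSeries σ K) ≠ 0 → r' + d ≤ m x + m y := by
    intro m hm
    rw [MvPolynomial.coeff_coe] at hm
    have := ordVar_add_dRes_le_of_mem_support x y hxy hσ F' m (MvPolynomial.mem_support_iff.mpr hm)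
    rw [hd] at this
    exact this
  set R' : ℕ → PowerSeries K := fun j => PowerSeries.mk fun a =>
    MvPowerSeries.coeff (Finsupp.single x a + Finsupp.single y j) (residualFlat (p ^ e) {x} ⟨y, x, h⟩ F') with hR'def
  have hR' : ∀ j v, PowerSeries.coeff v (R' j) = MvPowerSeries.coeff (Finsupp.single x (r' + v) + Finsupp.single y j)
      (cleanSeries (p ^ e) (MvPowerSeries.subst (fun l => if l = y then
        (MvPowerSeries.X y : MvPowerSeries σ K) + PowerSeries.subst (MvPowerSeries.X x : MvPowerSeries σ K) (-h)
        else MvPowerSeries.X l) (F' : MvPowerSeries σ K))) := by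
    intro j v
    rw [hR'def]
    exact coeff_row_residualFlat (p ^ e) x y hxy hσ {x} F' hr' h j v
  have hmin := cleanShift_rows_degree_ge (p ^ e) x y hxy hσ (F' : MvPowerSeries σ K) r' d hminH' (-h) hnegh R' hR'
  rw [sValue_eq_inf_of_le (p ^ e) {x} ⟨y, x, h⟩ F' (by rw [hd]; exact hqd), hd]
  exact factorial_le_inf_rows R' hmin

/-- **[HP24, Prop. 4 case (i)] ON THE ATLAS.**  Two letters, `q = pᵉ`, `E = excLetters s ∈ {∅, {x}}`, `F ≠ 0` clean,
`q < ord F`, `d_res ≥ q`, `a` not terminal.  Then the maximizing case-(i) flag `⟨y, x, h⋆⟩` at `a` (Proposition 3) has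
an invariant `(d_res, 0, s)` STRICTLY above the invariant `(d′_res, 0, s_𝓖)` of EVERY case-(i) flag `𝓖` of the successor
`step q x 0 s` (for which `E′ = {x}`): "`d_𝓖 = d′_res ≤ d_res = d_𝓕`. Assume that equality holds … `s_𝓖 = d_res!` [for
`G₁ = V(z,x)`] … This proves that `s_𝓖 < s_𝓕`." [cite: HauserPerlega2024, Prop. 4 proof case (i) p. 794 l. 22 – p. 795 l. 5] -/
theorem invCaseN0_step_lt (p : ℕ) [Fact p.Prime] [CharP K p] {e : ℕ} (x y : σ) (hxy : x ≠ y)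
    (hσ : ∀ l, l = x ∨ l = y) (s : State σ K) (hE : excLetters s = ∅ ∨ excLetters s = {x}) (hF : s.F ≠ 0)
    (hclean : deletePthPowers (p ^ e) s.F = s.F) (hq : ((p ^ e : ℕ) : ℕ∞) < ordZero s.F)
    (hqd : p ^ e ≤ dRes (excLetters s) s.F) (hnt : ¬ IsTerminalSub (p ^ e) (excLetters s) s.F) :
    ∃ hmax : PowerSeries K, PowerSeries.constantCoeff hmax = 0 ∧
      (∀ h' : PowerSeries K, PowerSeries.constantCoeff h' = 0 →
        sValue (p ^ e) (excLetters s) ⟨y, x, h'⟩ s.F ≤ sValue (p ^ e) (excLetters s) ⟨y, x, hmax⟩ s.F) ∧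
      ∀ G : FlagDatum σ K, G.IsCaseN0 (excLetters (step (p ^ e) x 0 s)) →
        invCaseN0 (p ^ e) (excLetters (step (p ^ e) x 0 s)) G (step (p ^ e) x 0 s).F <
          invCaseN0 (p ^ e) (excLetters s) ⟨y, x, hmax⟩ s.F := by
  classical
  set E := excLetters s with hEdef
  have hE' : excLetters (step (p ^ e) x 0 s) = {x} := by
    rw [excLetters_step_zero (p ^ e) x s hq hF, ← hEdef]
    rcases hE with h0 | h1
    · rw [h0]; rfl
    · rw [h1, Finset.insert_eq_of_mem (Finset.mem_singleton_self x)]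
  have hq' : ((p ^ e : ℕ) : ℕ∞) ≤ ordZero s.F := hq.le
  obtain ⟨hmax, hhmax, hStop, hge⟩ := exists_isGreatest_sValue p x y hxy hσ hE hF hclean hqd hnt
  refine ⟨hmax, hhmax, hge, fun G hG => ?_⟩
  rw [hE'] at hG ⊢
  set d := dRes E s.F with hddef
  set S := sValue (p ^ e) E ⟨y, x, hmax⟩ s.F with hSdef
  unfold invCaseN0
  rw [Prod.Lex.toLex_lt_toLex]
  rcases (dRes_step_le p x y hxy hσ s hE hF hclean hq').lt_or_eq with hlt | heq
  · left; exact hlt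
  · right
    refine ⟨heq, ?_⟩
    rw [Prod.Lex.toLex_lt_toLex]
    right
    refine ⟨rfl, ?_⟩
    -- finiteness of `S` and the flag `y + 0` of the successor
    obtain ⟨n, hn⟩ := ENat.ne_top_iff_exists.mp (ne_top_of_lt hStop)
    have h00 : PowerSeries.constantCoeff (0 : PowerSeries K) = 0 := map_zero _
    have hX0 : PowerSeries.constantCoeff (PowerSeries.X * (0 : PowerSeries K)) = 0 := by rw [mul_zero, map_zero]
    have hadd := sValue_step_add_factorial p x y hxy hσ s hE hF hclean hq' hqd heq 0 h00
    have hfac0 := factorial_le_sValue_step p x y hxy hσ s hqd heq 0 h00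
    have hbound : ((d.factorial : ℕ) : ℕ∞) + ((d.factorial : ℕ) : ℕ∞) ≤ S := by
      calc ((d.factorial : ℕ) : ℕ∞) + ((d.factorial : ℕ) : ℕ∞)
          ≤ sValue (p ^ e) {x} ⟨y, x, 0⟩ (step (p ^ e) x 0 s).F + ((d.factorial : ℕ) : ℕ∞) := add_le_add hfac0 le_rfl
        _ = sValue (p ^ e) E ⟨y, x, PowerSeries.X * 0⟩ s.F := hadd
        _ ≤ S := hge _ hX0
    -- the case split on the successor's flag
    obtain ⟨c, o, h⟩ := G
    obtain ⟨⟨hco, hh0⟩, hcx⟩ := hG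
    rcases hσ c with rfl | rfl
    · -- the swapped flag `G₁ = V(z, x)`: `h = 0`, `o = y`, `s_𝓖 = d!`
      have ho : o = y := by
        rcases hσ o with h1 | h1
        · exact absurd h1.symm hco
        · exact h1
      have hh : h = 0 := hcx (Finset.mem_singleton_self _)
      subst ho hh
      dsimp only
      rw [← hSdef, sValue_swap_step_eq_factorial p c o hxy hσ s hE hF hclean hq' hqd heq, ← hn]
      rw [← hn] at hbound
      have h1 : d.factorial + d.factorial ≤ n := by exact_mod_cast hbound
      have h2 : 1 ≤ d.factorial := Nat.factorial_pos d
      exact_mod_cast (show d.factorial < n by omega)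
    · -- a flag `G₁ = V(z₁, y + h(x))`: `s_𝓖 + d! ≤ s`
      have ho : o = x := by
        rcases hσ o with h1 | h1
        · exact h1
        · exact absurd h1.symm hco
      subst ho
      dsimp only
      obtain ⟨hmax', hhmax', -, -, hdrop⟩ := sValue_step_lt_max p o c hxy hσ s hE hF hclean hq' hqd heq hnt
      exact lt_of_lt_of_le (hdrop h hh0) (hge hmax' hhmax')

end CaseOne

end HauserPerlega2024

end Literature.AlgebraicGeometry.Resolution
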